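import Literature.Analysis.SpecialFunctions.SelbergIntegralBasic
import Mathlib.Analysis.SpecialFunctions.Pow.Deriv
import Mathlib.Analysis.Calculus.Deriv.Mul
import Mathlib.MeasureTheory.Integral.Prod
import Mathlib.MeasureTheory.Integral.IntervalIntegral.FundThmCalculus
import HarnessLib

/-!
# Aomoto's integration by parts for the Selberg integral: the calculus identity

This file carries out the analytic half of K. Aomoto's proof of Selberg's formula
(K. Aomoto, SIAM J. Math. Anal. 18 (1987) 545–549; G. E. Andrews, R. Askey, R. Roy,
*Special Functions* (1999), §8.2; survey: P. J. Forrester, S. O. Warnaar, Bull. AMS 45 (2008)):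
in the regime `a, b, c ≥ 1`, where every function involved is continuous on the compact cube,

  `0 = ∫_{[0,1]^{m+1}} ∂/∂t₀ [ t₀(1-t₀) · e_K(t) · W(t) ] dt`

is expanded into

  `a ∫ (1-t₀) e_K W - b ∫ t₀ e_K W + 2c ∑_{j} ∫ t₀(1-t₀) e_K · dWeight₀ⱼ = 0`,

where `W = Selberg.weight (m+1) a b c`, `e_K(t) = ∏_{i∈K} tᵢ` for a set `K` of indices not
containing `0`, and `dWeight₀ⱼ` is the Selberg weight with its pair factor `((t₀-tⱼ)²)^c`
replaced by `(t₀-tⱼ)((t₀-tⱼ)²)^{c-1}` (so that `(t₀-tⱼ) · dWeight₀ⱼ = W`). Ingredients: splitting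
off the coordinate `t₀` (`Fin.cons`), Fubini over `[0,1] × [0,1]^m`, and the fundamental theorem
of calculus in `t₀` (the boundary terms vanish because `a, b ≥ 1`).

Everything here is fully proved; no named facts.
-/

noncomputable section

open MeasureTheory Real Finset Set

namespace Literature.Analysis.SpecialFunctions

namespace Selberg

/-! ### The pair product with one pair removed, and the differentiated weight -/

/-- The symmetric pair product `∏ᵢ ∏_{l≠i} |tᵢ - tₗ|^c` with the two ordered pairs `(p,q)`, `(q,p)`
omitted. [folklore] -/
def pairDrop (n : ℕ) (c : ℝ) (p q : Fin n) (t : Fin n → ℝ) : ℝ :=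
  ∏ i : Fin n, ∏ l : Fin n,
    if i = l ∨ (i = p ∧ l = q) ∨ (i = q ∧ l = p) then 1 else |t i - t l| ^ c

/-- The Selberg weight with its pair factor `((t_p - t_q)²)^c` replaced by
`(t_p - t_q)((t_p - t_q)²)^{c-1}`, i.e. `(2c)⁻¹ ∂/∂t_p` applied to that factor only. [folklore] -/
def dWeight (n : ℕ) (a b c : ℝ) (p q : Fin n) (t : Fin n → ℝ) : ℝ :=
  body n a b t * ((t p - t q) * ((t p - t q) ^ 2) ^ (c - 1)) * pairDrop n c p q t

/-- `(y²)^c = |y|^c · |y|^c`. [folklore] -/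
theorem sq_rpow_eq_abs_rpow_mul (y c : ℝ) : (y ^ 2) ^ c = |y| ^ c * |y| ^ c := by
  rw [abs_rpow_mul_self, ← sq_abs, Real.rpow_mul (abs_nonneg y)]
  norm_num

/-- `y · y^{c-1} = y^c` for `y ≥ 0`, `c ≥ 1`. [folklore] -/
theorem mul_rpow_sub_one {y c : ℝ} (hy : 0 ≤ y) (hc : 1 ≤ c) : y * y ^ (c - 1) = y ^ c := by
  rcases eq_or_lt_of_le hy with h | h
  · subst h
    rw [zero_mul, Real.zero_rpow (by linarith)]
  · rw [Real.rpow_sub_one h.ne', mul_div_cancel₀ _ h.ne']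

/-- `x^a = x · x^{a-1}` for `x ≥ 0`, `a ≥ 1`. [folklore] -/
theorem rpow_eq_mul_rpow_sub_one {x a : ℝ} (hx : 0 ≤ x) (ha : 1 ≤ a) : x ^ a = x * x ^ (a - 1) :=
  (mul_rpow_sub_one hx ha).symm

/-- The symmetric pair product factors as the `(p,q)` pair factor times `pairDrop`.
[folklore] -/
theorem pairSym_eq_sq_rpow_mul_pairDrop {n : ℕ} (c : ℝ) {p q : Fin n} (hpq : p ≠ q)
    (t : Fin n → ℝ) : pairSym n c t = ((t p - t q) ^ 2) ^ c * pairDrop n c p q t := by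
  classical
  unfold pairSym pairDrop
  -- write each factor of `pairSym` as (factor of `pairDrop`) · (extra factor)
  set E : Fin n → Fin n → ℝ := fun i l =>
    if (i = p ∧ l = q) ∨ (i = q ∧ l = p) then |t i - t l| ^ c else 1 with hE
  have hfac : ∀ i l : Fin n, (if i = l then (1 : ℝ) else |t i - t l| ^ c) =
      (if i = l ∨ (i = p ∧ l = q) ∨ (i = q ∧ l = p) then (1 : ℝ) else |t i - t l| ^ c) *
        E i l := by
    intro i l
    simp only [hE]
    by_cases hil : i = l
    · subst hil
      have h1 : ¬((i = p ∧ i = q) ∨ (i = q ∧ i = p)) := by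
        rintro (⟨rfl, rfl⟩ | ⟨rfl, rfl⟩) <;> exact hpq rfl
      simp [h1]
    · by_cases h2 : (i = p ∧ l = q) ∨ (i = q ∧ l = p)
      · simp [hil, h2]
      · simp [hil, h2]
  simp_rw [hfac, prod_mul_distrib]
  rw [mul_comm]
  congr 1
  -- the product of the extra factors is `|t p - t q|^c |t q - t p|^c = ((t p - t q)^2)^c`
  have hrow : ∀ i : Fin n, ∏ l, E i l =
      if i = p then |t p - t q| ^ c else if i = q then |t q - t p| ^ c else 1 := by
    intro i
    by_cases hip : i = p
    · subst hip
      rw [if_pos rfl, Finset.prod_eq_single q]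
      · simp [hE]
      · intro l _ hl
        simp only [hE]
        rw [if_neg]
        rintro (⟨_, h⟩ | ⟨h, _⟩)
        · exact hl h
        · exact hpq h
      · simp
    · by_cases hiq : i = q
      · subst hiq
        rw [if_neg hip, if_pos rfl, Finset.prod_eq_single p]
        · simp [hE, hpq.symm]
        · intro l _ hl
          simp only [hE]
          rw [if_neg]
          rintro (⟨h, _⟩ | ⟨_, h⟩)
          · exact hip h
          · exact hl h
        · simp
      · rw [if_neg hip, if_neg hiq]
        refine Finset.prod_eq_one fun l _ => ?_
        simp only [hE]
        rw [if_neg]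
        rintro (⟨h, _⟩ | ⟨h, _⟩)
        · exact hip h
        · exact hiq h
  simp_rw [hrow]
  rw [Finset.prod_eq_mul p q hpq]
  · simp only [if_true, if_neg (Ne.symm hpq)]
    rw [abs_sub_comm (t q) (t p), sq_rpow_eq_abs_rpow_mul]
  · intro i _ hi
    rw [if_neg hi.1, if_neg hi.2]
  · simp
  · simp

/-- The Selberg weight factors as the `(p,q)` pair factor times `body · pairDrop`. [folklore] -/
theorem weight_eq_sq_rpow_mul {n : ℕ} (a b c : ℝ) {p q : Fin n} (hpq : p ≠ q)
    (t : Fin n → ℝ) :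
    weight n a b c t = ((t p - t q) ^ 2) ^ c * (body n a b t * pairDrop n c p q t) := by
  rw [weight_eq_body_mul_pairSym, pairSym_eq_sq_rpow_mul_pairDrop c hpq]
  ring

/-- **`(t_p - t_q) · dWeight = weight`** (for `c ≥ 1`). [folklore] -/
theorem sub_mul_dWeight {n : ℕ} (a b : ℝ) {c : ℝ} (hc : 1 ≤ c) {p q : Fin n} (hpq : p ≠ q)
    (t : Fin n → ℝ) : (t p - t q) * dWeight n a b c p q t = weight n a b c t := by
  rw [weight_eq_sq_rpow_mul a b c hpq, dWeight, ← mul_rpow_sub_one (sq_nonneg (t p - t q)) hc]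
  ring

/-! ### Symmetry under the transposition of `p` and `q` -/

/-- `pairDrop` is invariant under the transposition `p ↔ q`. [folklore] -/
theorem pairDrop_comp_swap {n : ℕ} (c : ℝ) (p q : Fin n) (t : Fin n → ℝ) :
    pairDrop n c p q (t ∘ Equiv.swap p q) = pairDrop n c p q t := by
  classical
  unfold pairDrop
  set τ := Equiv.swap p q with hτ
  simp only [Function.comp_apply]
  -- reindex both products by `τ`
  have hcond : ∀ i l : Fin n, (i = l ∨ (i = p ∧ l = q) ∨ (i = q ∧ l = p)) ↔
      (τ i = τ l ∨ (τ i = p ∧ τ l = q) ∨ (τ i = q ∧ τ l = p)) := by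
    intro i l
    rw [τ.injective.eq_iff]
    have h1 : τ i = p ↔ i = q := by
      rw [hτ]; constructor
      · intro h; simpa using congrArg (Equiv.swap p q) h
      · intro h; rw [h]; exact Equiv.swap_apply_right p q
    have h2 : τ i = q ↔ i = p := by
      rw [hτ]; constructor
      · intro h; simpa using congrArg (Equiv.swap p q) h
      · intro h; rw [h]; exact Equiv.swap_apply_left p q
    have h3 : τ l = p ↔ l = q := by
      rw [hτ]; constructor
      · intro h; simpa using congrArg (Equiv.swap p q) h
      · intro h; rw [h]; exact Equiv.swap_apply_right p q
    have h4 : τ l = q ↔ l = p := by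
      rw [hτ]; constructor
      · intro h; simpa using congrArg (Equiv.swap p q) h
      · intro h; rw [h]; exact Equiv.swap_apply_left p q
    rw [h1, h2, h3, h4]
    tauto
  have hterm : ∀ i l : Fin n,
      (if i = l ∨ (i = p ∧ l = q) ∨ (i = q ∧ l = p) then (1 : ℝ) else |t (τ i) - t (τ l)| ^ c) =
      (fun i' l' => if i' = l' ∨ (i' = p ∧ l' = q) ∨ (i' = q ∧ l' = p) then (1 : ℝ)
        else |t i' - t l'| ^ c) (τ i) (τ l) := by
    intro i l
    simp only
    rw [if_congr (hcond i l) rfl rfl]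
  simp_rw [hterm]
  rw [Equiv.prod_comp τ (fun i' => ∏ l, (fun i' l' => if i' = l' ∨ (i' = p ∧ l' = q) ∨
    (i' = q ∧ l' = p) then (1 : ℝ) else |t i' - t l'| ^ c) i' (τ l))]
  refine prod_congr rfl fun i _ => ?_
  exact Equiv.prod_comp τ (fun l' => if i = l' ∨ (i = p ∧ l' = q) ∨ (i = q ∧ l' = p)
    then (1 : ℝ) else |t i - t l'| ^ c)

/-- **`dWeight` is antisymmetric** under the transposition `p ↔ q`. [folklore] -/
theorem dWeight_comp_swap {n : ℕ} (a b c : ℝ) (p q : Fin n) (t : Fin n → ℝ) :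
    dWeight n a b c p q (t ∘ Equiv.swap p q) = -dWeight n a b c p q t := by
  unfold dWeight
  rw [body_comp_perm, pairDrop_comp_swap]
  simp only [Function.comp_apply, Equiv.swap_apply_left, Equiv.swap_apply_right]
  have : (t q - t p) ^ 2 = (t p - t q) ^ 2 := by ring
  rw [this]
  ring

/-! ### Continuity -/

/-- `pairDrop` is continuous for `c ≥ 0`. [folklore] -/
theorem continuous_pairDrop {n : ℕ} {c : ℝ} (hc : 0 ≤ c) (p q : Fin n) :
    Continuous (pairDrop n c p q) := by
  unfold pairDrop
  refine continuous_finsetProd _ fun i _ => continuous_finsetProd _ fun l _ => ?_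
  split_ifs
  · exact continuous_const
  · exact Continuous.rpow_const (by fun_prop) fun _ => Or.inr hc

/-- `dWeight` is continuous for `a, b, c ≥ 1`. [folklore] -/
theorem continuous_dWeight {n : ℕ} {a b c : ℝ} (ha : 1 ≤ a) (hb : 1 ≤ b) (hc : 1 ≤ c)
    (p q : Fin n) : Continuous (dWeight n a b c p q) := by
  unfold dWeight
  refine ((continuous_body ha hb).mul ?_).mul (continuous_pairDrop (by linarith) p q)
  refine Continuous.mul (by fun_prop) ?_
  exact Continuous.rpow_const (by fun_prop) fun _ => Or.inr (by linarith)

/-! ### Splitting off the coordinate `0` -/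

/-- `body (m+1) a b (x ∷ u) = x^{a-1}(1-x)^{b-1} · body m a b u`. [folklore] -/
theorem body_cons (m : ℕ) (a b x : ℝ) (u : Fin m → ℝ) :
    body (m + 1) a b (Fin.cons x u) = x ^ (a - 1) * (1 - x) ^ (b - 1) * body m a b u := by
  simp only [body, Fin.prod_univ_succ, Fin.cons_zero, Fin.cons_succ]

/-- `pairSym (m+1) c (x ∷ u) = ∏ⱼ ((x-uⱼ)²)^c · pairSym m c u`. [folklore] -/
theorem pairSym_cons (m : ℕ) (c x : ℝ) (u : Fin m → ℝ) :
    pairSym (m + 1) c (Fin.cons x u) = (∏ j : Fin m, ((x - u j) ^ 2) ^ c) * pairSym m c u := by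
  have h0 : ∀ j : Fin m, ¬(0 : Fin (m + 1)) = j.succ := fun j => (Fin.succ_ne_zero j).symm
  simp only [pairSym, Fin.prod_univ_succ, Fin.cons_zero, Fin.cons_succ, Fin.succ_inj, h0,
    Fin.succ_ne_zero, if_true, if_false, one_mul]
  rw [prod_mul_distrib, ← mul_assoc, ← prod_mul_distrib]
  congr 1
  refine prod_congr rfl fun j _ => ?_
  rw [abs_sub_comm (u j) x, sq_rpow_eq_abs_rpow_mul]

/-- `pairDrop (m+1) c 0 (j+1) (x ∷ u) = ∏_{l ≠ j} ((x-uₗ)²)^c · pairSym m c u`. [folklore] -/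
theorem pairDrop_cons (m : ℕ) (c x : ℝ) (u : Fin m → ℝ) (j : Fin m) :
    pairDrop (m + 1) c 0 j.succ (Fin.cons x u) =
      (∏ l ∈ univ.erase j, ((x - u l) ^ 2) ^ c) * pairSym m c u := by
  have h0 : ∀ l : Fin m, ¬(0 : Fin (m + 1)) = l.succ := fun l => (Fin.succ_ne_zero l).symm
  simp only [pairDrop, pairSym, Fin.prod_univ_succ, Fin.cons_zero, Fin.cons_succ, Fin.succ_inj,
    h0, Fin.succ_ne_zero, true_and, false_and, and_true, and_false, or_false, false_or, if_true,
    one_mul]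
  rw [prod_mul_distrib, ← mul_assoc, ← prod_mul_distrib]
  congr 1
  rw [← Finset.prod_erase (s := Finset.univ) (a := j) (by simp)]
  refine prod_congr rfl fun l hl => ?_
  rw [Finset.mem_erase] at hl
  simp only [hl.1, if_false]
  rw [abs_sub_comm (u l) x, sq_rpow_eq_abs_rpow_mul]

/-- `x ∷ u ∈ [0,1]^{m+1} ↔ x ∈ [0,1] ∧ u ∈ [0,1]^m`. [folklore] -/
theorem cons_mem_cube_iff {m : ℕ} (x : ℝ) (u : Fin m → ℝ) :
    Fin.cons x u ∈ cube (m + 1) ↔ x ∈ Icc (0 : ℝ) 1 ∧ u ∈ cube m := by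
  simp only [mem_cube_iff, Fin.forall_fin_succ, Fin.cons_zero, Fin.cons_succ, Set.mem_Icc]

/-- For `0 ∉ K`, the monomial `∏_{i∈K} tᵢ` does not depend on `t₀`. [folklore] -/
theorem prod_cons_eq_of_not_mem {m : ℕ} {K : Finset (Fin (m + 1))} (hK : (0 : Fin (m + 1)) ∉ K)
    (x y : ℝ) (u : Fin m → ℝ) :
    ∏ i ∈ K, (Fin.cons x u : Fin (m + 1) → ℝ) i = ∏ i ∈ K, (Fin.cons y u : Fin (m + 1) → ℝ) i := by
  refine prod_congr rfl fun i hi => ?_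
  have hi0 : i ≠ 0 := fun h => hK (h ▸ hi)
  obtain ⟨j, rfl⟩ := Fin.exists_succ_eq.2 hi0
  simp

/-! ### Fubini: integrating out the coordinate `0` last -/

/-- Mathlib's `piFinSuccAbove` at `0` is `Fin.cons`. [folklore] -/
theorem piFinSuccAbove_symm_apply_eq_cons {m : ℕ} (p : ℝ × (Fin m → ℝ)) :
    (MeasurableEquiv.piFinSuccAbove (fun _ : Fin (m + 1) => ℝ) 0).symm p = Fin.cons p.1 p.2 := by
  simp [MeasurableEquiv.piFinSuccAbove_symm_apply, Fin.insertNthEquiv, Fin.insertNth_zero']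

/-- **Fubini on the cube**, coordinate `0` innermost:
`∫_{[0,1]^{m+1}} D = ∫_{u ∈ [0,1]^m} ∫_{x ∈ [0,1]} D(x ∷ u)`. [folklore] -/
theorem integral_cube_succ {m : ℕ} (D : (Fin (m + 1) → ℝ) → ℝ)
    (hD : IntegrableOn D (cube (m + 1))) :
    ∫ t in cube (m + 1), D t = ∫ u in cube m, ∫ x in Icc (0 : ℝ) 1, D (Fin.cons x u) := by
  set e := (MeasurableEquiv.piFinSuccAbove (fun _ : Fin (m + 1) => ℝ) 0).symm with he
  have hmp : MeasurePreserving e (volume.prod volume) volume :=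
    (volume_preserving_piFinSuccAbove (fun _ : Fin (m + 1) => ℝ) 0).symm _
  have happ : ∀ p, e p = Fin.cons p.1 p.2 := piFinSuccAbove_symm_apply_eq_cons
  have hpre : e ⁻¹' cube (m + 1) = Icc (0 : ℝ) 1 ×ˢ cube m := by
    ext ⟨x, u⟩
    rw [Set.mem_preimage, happ, cons_mem_cube_iff, Set.mem_prod]
  have h1 := hmp.setIntegral_preimage_emb e.measurableEmbedding D (cube (m + 1))
  rw [← h1, hpre]
  have hint : Integrable (fun p : ℝ × (Fin m → ℝ) => D (e p))
      ((volume.restrict (Icc (0 : ℝ) 1)).prod (volume.restrict (cube m))) := by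
    have h2 := hmp.restrict_preimage_emb e.measurableEmbedding (cube (m + 1))
    rw [hpre, ← Measure.prod_restrict] at h2
    exact (h2.integrable_comp_emb e.measurableEmbedding).2 hD
  rw [← Measure.prod_restrict, integral_prod_symm _ hint]
  simp only [happ]

/-! ### The fundamental theorem of calculus in the coordinate `0` -/

/-- Derivative of the `t₀`-section `x ↦ x^a (1-x)^b ∏ⱼ ((x-uⱼ)²)^c` (`a, b, c ≥ 1`), raw form.
[folklore] -/
theorem hasDerivAt_section {m : ℕ} {a b c : ℝ} (ha : 1 ≤ a) (hb : 1 ≤ b) (hc : 1 ≤ c)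
    (u : Fin m → ℝ) (x : ℝ) :
    HasDerivAt (fun x => x ^ a * (1 - x) ^ b * ∏ j : Fin m, ((x - u j) ^ 2) ^ c)
      ((a * x ^ (a - 1) * (1 - x) ^ b + x ^ a * (-1 * b * (1 - x) ^ (b - 1))) *
          (∏ j : Fin m, ((x - u j) ^ 2) ^ c) +
        x ^ a * (1 - x) ^ b *
          ∑ j : Fin m, (∏ l ∈ univ.erase j, ((x - u l) ^ 2) ^ c) *
            (2 * (x - u j) * c * ((x - u j) ^ 2) ^ (c - 1))) x := by
  classical
  have h1 : HasDerivAt (fun x => x ^ a) (a * x ^ (a - 1)) x := Real.hasDerivAt_rpow_const (Or.inr ha)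
  have h2 : HasDerivAt (fun x => (1 - x) ^ b) (-1 * b * (1 - x) ^ (b - 1)) x :=
    ((hasDerivAt_id x).const_sub 1).rpow_const (p := b) (Or.inr hb)
  have h3 : ∀ j : Fin m, HasDerivAt (fun x => ((x - u j) ^ 2) ^ c)
      (2 * (x - u j) * c * ((x - u j) ^ 2) ^ (c - 1)) x := by
    intro j
    have hin : HasDerivAt (fun x => (x - u j) ^ 2) (2 * (x - u j)) x := by
      have h := (hasDerivAt_id' x).sub_const (u j)
      have e : (fun x : ℝ => (x - u j) ^ 2) = fun x => (x - u j) * (x - u j) :=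
        funext fun x => sq _
      rw [e]
      exact (h.mul h).congr_deriv (by ring)
    exact hin.rpow_const (Or.inr hc)
  have h4 := HasDerivAt.fun_finsetProd (u := Finset.univ) (fun j _ => h3 j)
  exact (h1.mul h2).mul h4

/-- Derivative of the `t₀`-section at `x ∈ [0,1]`, in the factored form
`x^{a-1}(1-x)^{b-1}[(a(1-x) - bx) R(x) + x(1-x) R'(x)]`. [folklore] -/
theorem hasDerivAt_section' {m : ℕ} {a b c : ℝ} (ha : 1 ≤ a) (hb : 1 ≤ b) (hc : 1 ≤ c)
    (u : Fin m → ℝ) {x : ℝ} (hx : x ∈ Icc (0 : ℝ) 1) :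
    HasDerivAt (fun x => x ^ a * (1 - x) ^ b * ∏ j : Fin m, ((x - u j) ^ 2) ^ c)
      (x ^ (a - 1) * (1 - x) ^ (b - 1) *
        ((a * (1 - x) - b * x) * (∏ j : Fin m, ((x - u j) ^ 2) ^ c) +
          x * (1 - x) * ∑ j : Fin m, (∏ l ∈ univ.erase j, ((x - u l) ^ 2) ^ c) *
            (2 * (x - u j) * c * ((x - u j) ^ 2) ^ (c - 1)))) x := by
  refine (hasDerivAt_section ha hb hc u x).congr_deriv ?_
  rw [rpow_eq_mul_rpow_sub_one hx.1 ha, rpow_eq_mul_rpow_sub_one (by linarith [hx.2]) hb]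
  ring

/-- The factored derivative is continuous in `x` (`a, b, c ≥ 1`). [folklore] -/
theorem continuous_section_deriv {m : ℕ} {a b c : ℝ} (ha : 1 ≤ a) (hb : 1 ≤ b) (hc : 1 ≤ c)
    (u : Fin m → ℝ) :
    Continuous (fun x : ℝ => x ^ (a - 1) * (1 - x) ^ (b - 1) *
        ((a * (1 - x) - b * x) * (∏ j : Fin m, ((x - u j) ^ 2) ^ c) +
          x * (1 - x) * ∑ j : Fin m, (∏ l ∈ univ.erase j, ((x - u l) ^ 2) ^ c) *
            (2 * (x - u j) * c * ((x - u j) ^ 2) ^ (c - 1)))) := by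
  have hR : ∀ s : Finset (Fin m), Continuous (fun x : ℝ => ∏ l ∈ s, ((x - u l) ^ 2) ^ c) :=
    fun s => continuous_finsetProd _ fun l _ =>
      Continuous.rpow_const (by fun_prop) fun _ => Or.inr (by linarith)
  have hS : Continuous (fun x : ℝ => ∑ j : Fin m, (∏ l ∈ univ.erase j, ((x - u l) ^ 2) ^ c) *
      (2 * (x - u j) * c * ((x - u j) ^ 2) ^ (c - 1))) := by
    refine continuous_finsetSum _ fun j _ => (hR _).mul ?_
    refine Continuous.mul (by fun_prop) ?_
    exact Continuous.rpow_const (by fun_prop) fun _ => Or.inr (by linarith)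
  have ha' : Continuous (fun x : ℝ => x ^ (a - 1)) :=
    Continuous.rpow_const (by fun_prop) fun _ => Or.inr (by linarith)
  have hb' : Continuous (fun x : ℝ => (1 - x) ^ (b - 1)) :=
    Continuous.rpow_const (by fun_prop) fun _ => Or.inr (by linarith)
  exact (ha'.mul hb').mul (((by fun_prop : Continuous fun x : ℝ => a * (1 - x) - b * x).mul
    (hR _)).add ((by fun_prop : Continuous fun x : ℝ => x * (1 - x)).mul hS))

/-- **The boundary terms vanish**: `∫₀¹ (d/dx)[x^a(1-x)^b R(x)] dx = 0` for `a, b ≥ 1`.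
[folklore] -/
theorem integral_section_deriv_eq_zero {m : ℕ} {a b c : ℝ} (ha : 1 ≤ a) (hb : 1 ≤ b)
    (hc : 1 ≤ c) (u : Fin m → ℝ) :
    ∫ x in Icc (0 : ℝ) 1, x ^ (a - 1) * (1 - x) ^ (b - 1) *
        ((a * (1 - x) - b * x) * (∏ j : Fin m, ((x - u j) ^ 2) ^ c) +
          x * (1 - x) * ∑ j : Fin m, (∏ l ∈ univ.erase j, ((x - u l) ^ 2) ^ c) *
            (2 * (x - u j) * c * ((x - u j) ^ 2) ^ (c - 1))) = 0 := by
  rw [integral_Icc_eq_integral_Ioc, ← intervalIntegral.integral_of_le zero_le_one,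
    intervalIntegral.integral_eq_sub_of_hasDerivAt
      (f := fun x => x ^ a * (1 - x) ^ b * ∏ j : Fin m, ((x - u j) ^ 2) ^ c)
      (fun x hx => hasDerivAt_section' ha hb hc u (by rwa [Set.uIcc_of_le zero_le_one] at hx))
      ((continuous_section_deriv ha hb hc u).intervalIntegrable _ _)]
  have ha0 : a ≠ 0 := by linarith
  have hb0 : b ≠ 0 := by linarith
  simp [Real.zero_rpow ha0, Real.zero_rpow hb0]

/-! ### The calculus identity -/

/-- **Aomoto's calculus identity.** For `a, b, c ≥ 1` and a set `K` of indices with `0 ∉ K`,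
`a ∫ (1-t₀) e_K W - b ∫ t₀ e_K W + 2c ∑ⱼ ∫ t₀(1-t₀) e_K dWeight₀,ⱼ₊₁ = 0` over the cube, where
`e_K(t) = ∏_{i∈K} tᵢ` and `W` is the Selberg weight: this is
`∫ ∂/∂t₀ [t₀(1-t₀) e_K W] dt = 0` (Aomoto 1987; AAR §8.2). [folklore] -/
theorem aomoto_calculus_identity {m : ℕ} {a b c : ℝ} (ha : 1 ≤ a) (hb : 1 ≤ b) (hc : 1 ≤ c)
    (K : Finset (Fin (m + 1))) (hK : (0 : Fin (m + 1)) ∉ K) :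
    (a * ∫ t in cube (m + 1), (1 - t 0) * (∏ i ∈ K, t i) * weight (m + 1) a b c t)
      - (b * ∫ t in cube (m + 1), t 0 * (∏ i ∈ K, t i) * weight (m + 1) a b c t)
      + 2 * c * ∑ j : Fin m, ∫ t in cube (m + 1),
          t 0 * (1 - t 0) * (∏ i ∈ K, t i) * dWeight (m + 1) a b c 0 j.succ t = 0 := by
  -- abbreviations
  set W := weight (m + 1) a b c with hW
  set dW := fun j : Fin m => dWeight (m + 1) a b c 0 j.succ with hdW
  set e : (Fin (m + 1) → ℝ) → ℝ := fun t => ∏ i ∈ K, t i with he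
  -- continuity of everything in sight
  have hWc : Continuous W := continuous_weight ha hb (by linarith)
  have hdWc : ∀ j, Continuous (dW j) := fun j => continuous_dWeight ha hb hc 0 j.succ
  have hec : Continuous e := continuous_finsetProd _ fun i _ => continuous_apply i
  have h0c : Continuous fun t : Fin (m + 1) → ℝ => t 0 := continuous_apply 0
  have hT1 : Continuous fun t : Fin (m + 1) → ℝ => (1 - t 0) * e t * W t := by fun_prop
  have hT2 : Continuous fun t : Fin (m + 1) → ℝ => t 0 * e t * W t := by fun_prop
  have hT3 : ∀ j, Continuous fun t : Fin (m + 1) → ℝ => t 0 * (1 - t 0) * e t * dW j t := by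
    intro j; have := hdWc j; fun_prop
  have hint : ∀ {F : (Fin (m + 1) → ℝ) → ℝ}, Continuous F → IntegrableOn F (cube (m + 1)) :=
    fun hF => hF.continuousOn.integrableOn_compact (isCompact_cube _)
  -- the total integrand
  set D : (Fin (m + 1) → ℝ) → ℝ := fun t =>
    a * ((1 - t 0) * e t * W t) - b * (t 0 * e t * W t) +
      2 * c * ∑ j : Fin m, t 0 * (1 - t 0) * e t * dW j t with hD
  have hDc : Continuous D := by
    simp only [hD]
    exact ((continuous_const.mul hT1).sub (continuous_const.mul hT2)).add
      (continuous_const.mul (continuous_finsetSum _ fun j _ => hT3 j))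
  -- its integral is the left-hand side
  have hDint : ∫ t in cube (m + 1), D t =
      (a * ∫ t in cube (m + 1), (1 - t 0) * e t * W t)
        - (b * ∫ t in cube (m + 1), t 0 * e t * W t)
        + 2 * c * ∑ j : Fin m, ∫ t in cube (m + 1), t 0 * (1 - t 0) * e t * dW j t := by
    have i1 : Integrable (fun t : Fin (m + 1) → ℝ => a * ((1 - t 0) * e t * W t))
        (volume.restrict (cube (m + 1))) := (hint hT1).const_mul a
    have i2 : Integrable (fun t : Fin (m + 1) → ℝ => b * (t 0 * e t * W t))
        (volume.restrict (cube (m + 1))) := (hint hT2).const_mul b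
    have i3' : ∀ j ∈ (Finset.univ : Finset (Fin m)),
        Integrable (fun t : Fin (m + 1) → ℝ => t 0 * (1 - t 0) * e t * dW j t)
          (volume.restrict (cube (m + 1))) := fun j _ => hint (hT3 j)
    have i3 : Integrable (fun t : Fin (m + 1) → ℝ => 2 * c * ∑ j : Fin m, t 0 * (1 - t 0) * e t * dW j t)
        (volume.restrict (cube (m + 1))) := (integrable_finsetSum _ i3').const_mul (2 * c)
    have i12 : Integrable (fun t : Fin (m + 1) → ℝ =>
        a * ((1 - t 0) * e t * W t) - b * (t 0 * e t * W t)) (volume.restrict (cube (m + 1))) :=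
      i1.sub i2
    simp only [hD]
    rw [integral_add i12 i3, integral_sub i1 i2, integral_const_mul, integral_const_mul,
      integral_const_mul, integral_finsetSum _ i3']
  rw [← hDint, integral_cube_succ D (hint hDc)]
  -- on each `t₀`-fibre the integrand is `C(u) · φ'(x)`
  have hfib : ∀ (u : Fin m → ℝ) (x : ℝ), D (Fin.cons x u) =
      (e (Fin.cons 0 u) * body m a b u * pairSym m c u) *
        (x ^ (a - 1) * (1 - x) ^ (b - 1) *
          ((a * (1 - x) - b * x) * (∏ j : Fin m, ((x - u j) ^ 2) ^ c) +
            x * (1 - x) * ∑ j : Fin m, (∏ l ∈ univ.erase j, ((x - u l) ^ 2) ^ c) *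
              (2 * (x - u j) * c * ((x - u j) ^ 2) ^ (c - 1)))) := by
    intro u x
    have heK : e (Fin.cons x u) = e (Fin.cons 0 u) := prod_cons_eq_of_not_mem hK x 0 u
    have hWx : W (Fin.cons x u) = x ^ (a - 1) * (1 - x) ^ (b - 1) * body m a b u *
        ((∏ j : Fin m, ((x - u j) ^ 2) ^ c) * pairSym m c u) := by
      simp only [hW, weight_eq_body_mul_pairSym, body_cons, pairSym_cons]
    have hdWx : ∀ j : Fin m, dW j (Fin.cons x u) = x ^ (a - 1) * (1 - x) ^ (b - 1) * body m a b u *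
        ((x - u j) * ((x - u j) ^ 2) ^ (c - 1)) *
          ((∏ l ∈ univ.erase j, ((x - u l) ^ 2) ^ c) * pairSym m c u) := by
      intro j
      simp only [hdW, dWeight, body_cons, pairDrop_cons, Fin.cons_zero, Fin.cons_succ]
    simp only [hD, Fin.cons_zero, heK, hWx, hdWx]
    simp only [mul_add, Finset.mul_sum]
    congr 1
    · ring
    · refine Finset.sum_congr rfl fun j _ => ?_
      ring
  simp_rw [hfib, integral_const_mul, integral_section_deriv_eq_zero ha hb hc, mul_zero,
    integral_zero]

end Selberg

end Literature.Analysis.SpecialFunctions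

end
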